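import Summits.QuantumFields.BalabanUV.Beta.D1BFx.TorusGhostLegsSorted
import Literature.MathematicalPhysics.QuantumFieldTheory.Balaban1983to89.Beta.BalabanStepJetsSucc

/-!
# `BalabanUV.Beta.D1BFx.KGhostLeg` — road «BF-x» for binder row D1, slot (K), `K-ASSEMBLY-SPEC-v2.md` §4 brick **TB5-2c-B, PART 1: THE COMPOSITE
# GHOST LEG `Cgh` ON `ℤ⁴` AND ITS TORUS SOCKETS** (ruling ρ-g7-1 (1)).  TB5-2c-A (`KGhostTerm`, p244170) wrote the ghost term of route T under (R2)
# as `2·hessT (Ĉ; X-words) − hessT (Ĉ; (L̂²)-words)` with ONE scalar site leg `Ĉ = N̂(N̂ᵀL̂L̂N̂)⁻¹N̂ᵀ`, and leaf-03-g9's «TB4-W» PART 3a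
# (`TorusWeightJetsCombFree.Chat_eq`) identifies `Ĉ = (m+1)⁴•Ĝ′(1 − P̂)Ĝ′`.  Here: the `ℤ⁴` kernel **`Cgh n a := n⁴·(Ggh ∘ Rgt ∘ Ggh)`**
# (`GhostLeg.Ggh` = the scalar tower leg, `RJetProjector.Rgt = δ − Pgt` = the road's orthogonal projector onto `Δ₀(𝔫_av)`), its decay, block
# covariance and symmetry-free torus letters: on every fine torus `Site 4 s` with `n ∣ s`,
#   `(Cgh)^ = n⁴ • (Ggh)^·(Rgt)^·(Ggh)^`  and  `(Rgt)^ = (1 − P̂)` re-indexed,  hence  `(Cgh)^ = (n⁴ • Ĝ′(1 − P̂)Ĝ′)` re-indexed,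
# and the TA3b SOCKET `hessT ((Cgh)^; (arr 𝒱)^, (arr 𝒱′)^, (arr 𝒲)^) → hessKer (Cgh n a) 𝒱 𝒲 μ ν z` along `Site 4 (n·p k)`, `p k → ∞`
# — so both scalar functionals of TB5-2c-A converge to `ℤ⁴` one-loop functionals of the ONE leg `Cgh` once the site words are periodised arrays
# (PART 3b of «TB4-W»); the junction `Chat ((m+1)p) N̂ = ((Cgh (m+1) a)^).submatrix ι ι` is PART 2 (one line over `Chat_eq`, files on p243697)

HONEST FRAMING (cell contract, verbatim): «discharging `BetaPertH` makes Bałaban's UV stability UNCONDITIONAL — a real constructive-QFT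
result; it is NOT the continuum limit and NOT the Clay problem.»  HONEST DEPENDENCY (verbatim): «continuum YM on T⁴ ⇐ BetaPertH ∧ nine
spine estimates (0/9 proved); BetaPertH ⇐ (D1) ∧ (D4) ∧ CAP+tail; G-an2-4 gates asym, D1 and NE2/3/4.»  THIS MODULE DISCHARGES NOTHING of
D1 / BetaPertH: ONE [our object] re-indexing definition (`Cgh`, asserting nothing) + ONE explicit rate constant (`deltaCgh`) and [folklore]
compositions BY NAME (the typer's `GhostLeg` (`decays_Ggh`, `shiftK_Ggh`), leaf-05-g3's `RJetProjector` (`decays_Rgt`, `shiftK_Rgt`), ne9-leaf-09-g38's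
`TorusGhostLegs`, an4's `periodise₂` dictionary, this lineage's `FibredPeriodisation`∕`PeriodicArrays`∕`TorusTraceTadpole`).  No `def … : Prop`, nothing
cited, 0 sorry.  NOT summit progress; NOT BetaPertH, NOT continuum, NOT Clay.

ABSOLUTE RULE (cell, verbatim): «No internally-minted statement may enter as a cited fact. Every hypothesis is either kernel-proved in this
package or a verbatim quotation of a PUBLISHED theorem with page reference. The manuscript(s) under audit are NOT citable for their own
disputed steps — they are the thing under adjudication; programme-internal (2001/route/tribunal) claims are never citable.»

CONTENT (block side `n ≥ 1`, `0 < a`; all [folklore] unless marked).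
* §1 [our object] `Cgh`, `deltaCgh`; `decays_mul_const`, `shiftK_mul_const`, **`decays_Cgh`** (∃ constant, rate `deltaCgh n a > 0`), **`shiftK_Cgh`**,
  `Cgh_imageShift`, `isPeriodic₂_Cgh`.
* §2 on the fine torus `Site 4 s`, `n ∣ s`: `periodiseF_toF_Rgt_eq_submatrix` (`(Rgt)^ = (1 − P̂).submatrix Prod.fst Prod.fst`), the product letters
  `periodiseF_toF_comp` (two decaying block-covariant scalar kernels), **`periodiseF_toF_Cgh`** (`(Cgh)^ = n⁴ • (Ggh)^·(Rgt)^·(Ggh)^`),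
  **`periodiseF_toF_Cgh_eq_submatrix`** (`= (n⁴ • Ĝ′(1 − P̂)Ĝ′).submatrix Prod.fst Prod.fst`), `submatrix_unit_periodiseF_toF_Cgh` (the `Site × Unit → Site` reading).
* §3 sockets: `Cgh_imageShift_mul`, **`tendsto_hessT_Cgh`** (TA3b `tendsto_hessT_hessKer` at `F = Unit`), `hessT_submatrix_unit` (re-indexing `Site ≃ Site × Unit`).
Unit `b2b-balaban-beta-d1-p2` (road owner, gen 7).
-/

noncomputable section

namespace Summit.QuantumFields.BalabanUV.Beta.D1BFx.KGhostLeg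

open Filter Topology
open scoped BigOperators
open Literature.MathematicalPhysics.QuantumFieldTheory.Balaban1983to89
open Literature.MathematicalPhysics.QuantumFieldTheory.Balaban1983to89.Beta
open B12Sec2to5 (l1)
open B6QGQDecay237 (deltaU deltaU_pos)
open ExpKernelCalculus (Site MKer Decays BiLoc comp hessKer shiftK comp_shiftK Zl)
open KernelWard (Bdd bdd_of_decays)
open Literature.MathematicalPhysics.QuantumFieldTheory.Balaban1983to89.Beta.BalabanStepJetsSucc (decays_comp)
open Summit.QuantumFields.BalabanUV.Beta.TameKernelCalculus (decays_of_le)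
open Summit.QuantumFields.BalabanUV.Beta.D1BFx.FibredPeriodisation (Kfib compF periodiseF periodiseF_apply periodiseF_compF_matrix)
open Summit.QuantumFields.BalabanUV.Beta.D1BFx.PeriodicArrays (arr toF toF_apply Kfib_toF periodic_of_shiftK)
open Summit.QuantumFields.BalabanUV.Beta.D1BFx.MixedVarPackedHess (hessT)
open Summit.QuantumFields.BalabanUV.Beta.D1BFx.SortedEmbedding (hessT_submatrix_equiv)
open Summit.QuantumFields.BalabanUV.Beta.D1BFx.RProjector (Pgt Pgt_apply cPP deltaPP deltaPP_pos)
open Summit.QuantumFields.BalabanUV.Beta.D1BFx.RJetProjector (Rgt Rgt_apply decays_Rgt shiftK_Rgt)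
open Summit.QuantumFields.BalabanUV.Beta.D1BFx.PeriodisedKernels (summable_abs_row_Pker)
open Summit.QuantumFields.BalabanUV.Beta.D1BFx.GhostLeg (Ggh decays_Ggh shiftK_Ggh)
open Summit.QuantumFields.BalabanUV.Beta.D1BFx.TorusGhostLegs (isPeriodic₂_Ggh rowBound_Ggh periodiseF_Ggh_eq_submatrix tendsto_mul_period)
open Summit.QuantumFields.BalabanUV.Beta.D1BFx.TorusTraceTadpole (summable_abs_row_toF summable_mul_of_decays_bdd toF_comp tendsto_hessT_hessKer)
open Summit.QuantumFields.BalabanUV.Beta.D1BFx.PeriodisedProjector (Ghat Phat)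

/-! ## §1 The composite ghost leg on `ℤ⁴` -/

section Leg

variable (n : ℕ) [NeZero n] (a : ℝ)

/-- [our object] **THE COMPOSITE GHOST LEG** `Cgh n a := n⁴ · (Ggh ∘ (δ − Pgt) ∘ Ggh)` on `ℤ⁴` (scalar fibre `Unit`): the `ℤ⁴` kernel whose
periodisation is TB5-2c-A's site leg `Ĉ = N̂(N̂ᵀL̂L̂N̂)⁻¹N̂ᵀ` (via «TB4-W» 3a `Chat_eq`).  A definition; asserts nothing. -/
def Cgh : MKer 4 Unit := fun x y u v => (n : ℝ) ^ 4 * comp (Ggh n a) (comp (Rgt n a) (Ggh n a)) x y u v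

/-- [our object] Unfolding `Cgh`. -/
theorem Cgh_apply (x y : Site 4) (u v : Unit) : Cgh n a x y u v = (n : ℝ) ^ 4 * comp (Ggh n a) (comp (Rgt n a) (Ggh n a)) x y u v := rfl

/-- [our object] An explicit decay RATE for `Cgh`: a quarter of the common rate of `Ggh` (`deltaU 4 a ∕ 4n`) and `Rgt` (`deltaPP 4 a ∕ 4n`). -/
def deltaCgh : ℝ := min (deltaU 4 a / (4 * n)) (deltaPP 4 a / (4 * n)) / 4

/-- [folklore] `0 < n` as a real number (`NeZero n`). -/
theorem n_cast_pos : 0 < (n : ℝ) := Nat.cast_pos.2 (Nat.pos_of_ne_zero (NeZero.ne n))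

/-- [folklore] The rate `deltaCgh n a` is positive for `0 < a`. -/
theorem deltaCgh_pos (ha : 0 < a) : 0 < deltaCgh n a := by
  unfold deltaCgh
  have h4 : 0 < 4 * (n : ℝ) := mul_pos four_pos (n_cast_pos n)
  exact div_pos (lt_min (div_pos (deltaU_pos 4 ha) h4) (div_pos (deltaPP_pos 4 ha) h4)) four_pos

omit [NeZero n] in
/-- [folklore] Scaling a decaying kernel by a constant. -/
theorem decays_mul_const {D : ℕ} {F : Type*} {K : MKer D F} {C δ : ℝ} (c : ℝ) (h : Decays K C δ) :
    Decays (fun x y u v => c * K x y u v) (|c| * C) δ := by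
  intro x y u v
  rw [abs_mul, mul_assoc]
  exact mul_le_mul_of_nonneg_left (h x y u v) (abs_nonneg c)

omit [NeZero n] in
/-- [folklore] Scaling commutes with `shiftK`. -/
theorem shiftK_mul_const {D : ℕ} {F : Type*} (K : MKer D F) (c : ℝ) (w : Site D) :
    shiftK w (fun x y u v => c * K x y u v) = fun x y u v => c * shiftK w K x y u v := rfl

/-- [folklore] **`Cgh` DECAYS** at rate `deltaCgh n a` (`GhostLeg.decays_Ggh`, `RJetProjector.decays_Rgt`, `decays_comp` twice). -/
theorem decays_Cgh (ha : 0 < a) : ∃ C : ℝ, Decays (Cgh n a) C (deltaCgh n a) := by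
  set δm : ℝ := min (deltaU 4 a / (4 * n)) (deltaPP 4 a / (4 * n)) with hδm
  have h4 : 0 < 4 * (n : ℝ) := mul_pos four_pos (n_cast_pos n)
  have hδm_pos : 0 < δm := lt_min (div_pos (deltaU_pos 4 ha) h4) (div_pos (deltaPP_pos 4 ha) h4)
  have hG : Decays (Ggh n a) (|2 / min 2 a|) δm := decays_of_le (decays_Ggh n a ha) (min_le_left _ _)
  have hR : Decays (Rgt n a) (|1 + cPP 4 (n - 1) a * Real.exp (deltaPP 4 a)|) δm := decays_of_le (decays_Rgt n a ha) (min_le_right _ _)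
  have hRG := decays_comp hR hG (le_of_lt (half_pos hδm_pos)) (half_lt_self hδm_pos)
  have hG' : Decays (Ggh n a) (|(|2 / min 2 a|)|) (δm / 2) := decays_of_le hG (le_of_lt (half_lt_self hδm_pos))
  have hq : δm / 2 / 2 < δm / 2 := half_lt_self (half_pos hδm_pos)
  have hGRG := decays_comp hG' hRG (le_of_lt (half_pos (half_pos hδm_pos))) hq
  have e : deltaCgh n a = δm / 2 / 2 := by rw [deltaCgh, hδm]; ring
  have h := decays_mul_const ((n : ℝ) ^ 4) hGRG
  rw [← e] at h
  exact ⟨_, h⟩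

/-- [folklore] **BLOCK COVARIANCE OF `Cgh`**: `shiftK (n•t) (Cgh n a) = Cgh n a` (`comp_shiftK`, `shiftK_Ggh`, `shiftK_Rgt`). -/
theorem shiftK_Cgh (ha : 0 < a) (t : Site 4) : shiftK ((n : ℤ) • t) (Cgh n a) = Cgh n a := by
  show shiftK ((n : ℤ) • t) (fun x y u v => (n : ℝ) ^ 4 * comp (Ggh n a) (comp (Rgt n a) (Ggh n a)) x y u v) = _
  rw [shiftK_mul_const, ← comp_shiftK, ← comp_shiftK, shiftK_Ggh n a ha, shiftK_Rgt n ha]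
  rfl

/-- [folklore] Joint `s`-periodicity of `Cgh` for `n ∣ s`. -/
theorem Cgh_imageShift (ha : 0 < a) {s : ℕ} (hdiv : n ∣ s) (x y t : Site 4) (u v : Unit) :
    Cgh n a (imageShift s x t) (imageShift s y t) u v = Cgh n a x y u v := by
  obtain ⟨q, rfl⟩ := hdiv
  refine periodic_of_shiftK (fun t' => ?_) x y t u v
  have e : ((n * q : ℕ) : ℤ) • t' = (n : ℤ) • ((q : ℤ) • t') := by rw [Nat.cast_mul, mul_smul]
  rw [e]
  exact shiftK_Cgh n a ha _

/-- [folklore] … in an4's vocabulary. -/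
theorem isPeriodic₂_Cgh (ha : 0 < a) {s : ℕ} (hdiv : n ∣ s) (u v : Unit) : IsPeriodic₂ s (Kfib (toF (Cgh n a)) u v) :=
  fun x y t => Cgh_imageShift n a ha hdiv x y t u v

/-- [folklore] Joint periodicity of `Rgt` for `n ∣ s`. -/
theorem Rgt_imageShift (ha : 0 < a) {s : ℕ} (hdiv : n ∣ s) (x y t : Site 4) (u v : Unit) :
    Rgt n a (imageShift s x t) (imageShift s y t) u v = Rgt n a x y u v := by
  obtain ⟨q, rfl⟩ := hdiv
  refine periodic_of_shiftK (fun t' => ?_) x y t u v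
  have e : ((n * q : ℕ) : ℤ) • t' = (n : ℤ) • ((q : ℤ) • t') := by rw [Nat.cast_mul, mul_smul]
  rw [e]
  exact shiftK_Rgt n ha _

/-- [folklore] … in an4's vocabulary. -/
theorem isPeriodic₂_Rgt (ha : 0 < a) {s : ℕ} (hdiv : n ∣ s) (u v : Unit) : IsPeriodic₂ s (Kfib (toF (Rgt n a)) u v) :=
  fun x y t => Rgt_imageShift n a ha hdiv x y t u v

/-- [folklore] A uniform `ℓ¹` row bound for `Rgt`, from `decays_Rgt`. -/
theorem rowBound_Rgt (ha : 0 < a) (u v : Unit) :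
    RowBound (Kfib (toF (Rgt n a)) u v)
      ((1 + cPP 4 (n - 1) a * Real.exp (deltaPP 4 a)) * ∑' w : Site 4, Real.exp (-(deltaPP 4 a / (4 * n)) * l1 w)) := by
  have h2 : Decay₂ (Kfib (toF (Rgt n a)) u v) (1 + cPP 4 (n - 1) a * Real.exp (deltaPP 4 a)) (deltaPP 4 a / (4 * n)) := fun x y => by
    rw [Kfib_toF]; exact decays_Rgt n a ha x y u v
  exact h2.rowBound (div_pos (deltaPP_pos 4 ha) (mul_pos four_pos (n_cast_pos n)))

end Leg

/-! ## §2 On the fine torus: `(Cgh)^ = n⁴ • (Ggh)^·(Rgt)^·(Ggh)^ = (n⁴ • Ĝ′(1 − P̂)Ĝ′)` re-indexed -/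

section Torus

variable (n : ℕ) [NeZero n] (a : ℝ) {s : ℕ} [NeZero s]

omit [NeZero n] in
/-- [folklore] **`(Rgt)^ = 1 − P̂` RE-INDEXED**: the fibred periodisation of `δ − Pgt` is the owner's `1 − Phat (n−1) a s` along `Prod.fst`
(`periodise₂_add`∕`periodise₂_const_mul`∕`periodise₂_kdelta`). -/
theorem periodiseF_toF_Rgt_eq_submatrix (ha : 0 < a) :
    Matrix.of (periodiseF s (toF (Rgt n a))) = ((1 : Matrix (Site 4 s) (Site 4 s) ℝ) - Phat (n - 1) a s).submatrix Prod.fst Prod.fst := by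
  ext ⟨x, u⟩ ⟨y, v⟩
  rw [Matrix.submatrix_apply, Matrix.sub_apply, Matrix.one_apply, Matrix.of_apply, periodiseF_apply]
  have e : Kfib (toF (Rgt n a)) u v = (kdelta (d := 4)) + (fun p q : Site 4 => (-1) * RProjector.Pker (d := 4) (n - 1) a p q) := by
    funext p q
    show Rgt n a p q u v = kdelta p q + (-1) * RProjector.Pker (d := 4) (n - 1) a p q
    rw [Rgt_apply, Pgt_apply]
    simp only [kdelta]
    ring
  have hrow1 : ∀ p : Site 4, Summable (fun q => kdelta (d := 4) p q) := fun p => (summable_abs_kdelta p).of_abs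
  have hrow2 : ∀ p : Site 4, Summable (fun q => (-1) * RProjector.Pker (d := 4) (n - 1) a p q) := fun p =>
    ((summable_abs_row_Pker (n - 1) ha p).of_abs).mul_left _
  rw [e, periodise₂_add hrow1 hrow2, periodise₂_const_mul, periodise₂_kdelta]
  show _ = (if x = y then (1 : ℝ) else 0) - Phat (n - 1) a s x y
  rw [PeriodisedProjector.Phat_apply]
  ring

variable {A B : MKer 4 Unit} {CA CB δA δB : ℝ}

/-- [folklore] **TORUS PRODUCT LETTER FOR TWO DECAYING BLOCK-PERIODIC SCALAR KERNELS**: `(A ∘ B)^ = A^ · B^` on `Site 4 s`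
(`TorusTraceTadpole.toF_comp` + `FibredPeriodisation.periodiseF_compF_matrix`). -/
theorem periodiseF_toF_comp (hA : Decays A CA δA) (hδA : 0 < δA) (hB : Decays B CB δB) (hδB : 0 < δB)
    (hBper : ∀ u v : Unit, IsPeriodic₂ s (Kfib (toF B) u v)) :
    Matrix.of (periodiseF s (toF (comp A B))) = Matrix.of (periodiseF s (toF A)) * Matrix.of (periodiseF s (toF B)) := by
  have hBrow : ∀ u v : Unit, RowBound (Kfib (toF B) u v) (CB * ∑' w : Site 4, Real.exp (-δB * l1 w)) := fun u v => by
    have h2 : Decay₂ (Kfib (toF B) u v) CB δB := fun x y => by rw [Kfib_toF]; exact hB x y u v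
    exact h2.rowBound hδB
  rw [← toF_comp (fun x z u v f => summable_mul_of_decays_bdd hA hδA (bdd_of_decays hB hδB.le) x z u v f),
    periodiseF_compF_matrix (fun u v x => summable_abs_row_toF hA hδA u v x) hBper hBrow]

/-- [folklore] Scaling passes through the fibred periodisation. -/
theorem periodiseF_toF_mul_const (K : MKer 4 Unit) (c : ℝ) :
    Matrix.of (periodiseF s (toF (fun x y u v => c * K x y u v))) = c • Matrix.of (periodiseF s (toF K)) := by
  ext ⟨x, u⟩ ⟨y, v⟩
  rw [Matrix.smul_apply, Matrix.of_apply, Matrix.of_apply, periodiseF_apply, periodiseF_apply, smul_eq_mul, ← periodise₂_const_mul]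
  rfl

/-- [folklore] **`(Cgh)^ = n⁴ • (Ggh)^·(Rgt)^·(Ggh)^`** on every fine torus `Site 4 s` with `n ∣ s`. -/
theorem periodiseF_toF_Cgh (ha : 0 < a) (hdiv : n ∣ s) :
    Matrix.of (periodiseF s (toF (Cgh n a)))
      = ((n : ℝ) ^ 4) • (Matrix.of (periodiseF s (toF (Ggh n a))) * Matrix.of (periodiseF s (toF (Rgt n a)))
          * Matrix.of (periodiseF s (toF (Ggh n a)))) := by
  have h4 : 0 < 4 * (n : ℝ) := mul_pos four_pos (n_cast_pos n)
  have hδG : 0 < deltaU 4 a / (4 * n) := div_pos (deltaU_pos 4 ha) h4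
  have hδR : 0 < deltaPP 4 a / (4 * n) := div_pos (deltaPP_pos 4 ha) h4
  have hG := decays_Ggh n a ha
  have hR := decays_Rgt n a ha
  -- the inner product `Rgt ∘ Ggh`
  have hRG : Matrix.of (periodiseF s (toF (comp (Rgt n a) (Ggh n a))))
      = Matrix.of (periodiseF s (toF (Rgt n a))) * Matrix.of (periodiseF s (toF (Ggh n a))) :=
    periodiseF_toF_comp hR hδR hG hδG (isPeriodic₂_Ggh n a ha hdiv)
  -- its decay and periodicity, for the outer product
  set δm : ℝ := min (deltaU 4 a / (4 * n)) (deltaPP 4 a / (4 * n)) with hδm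
  have hδm_pos : 0 < δm := lt_min hδG hδR
  have hRG_dec := decays_comp (decays_of_le hR (min_le_right _ _ : δm ≤ _)) (decays_of_le hG (min_le_left _ _ : δm ≤ _))
    (le_of_lt (half_pos hδm_pos)) (half_lt_self hδm_pos)
  have hRG_per : ∀ u v : Unit, IsPeriodic₂ s (Kfib (toF (comp (Rgt n a) (Ggh n a))) u v) := by
    intro u v x y t
    show comp (Rgt n a) (Ggh n a) (imageShift s x t) (imageShift s y t) u v = comp (Rgt n a) (Ggh n a) x y u v
    obtain ⟨q, rfl⟩ := hdiv
    refine periodic_of_shiftK (fun t' => ?_) x y t u v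
    have e : ((n * q : ℕ) : ℤ) • t' = (n : ℤ) • ((q : ℤ) • t') := by rw [Nat.cast_mul, mul_smul]
    rw [e, ← comp_shiftK, shiftK_Ggh n a ha, shiftK_Rgt n ha]
  have hGRG := periodiseF_toF_comp hG hδG hRG_dec (half_pos hδm_pos) hRG_per
  show Matrix.of (periodiseF s (toF (fun x y u v => (n : ℝ) ^ 4 * comp (Ggh n a) (comp (Rgt n a) (Ggh n a)) x y u v))) = _
  rw [periodiseF_toF_mul_const, hGRG, hRG, Matrix.mul_assoc]

/-- [folklore] **`(Cgh)^ = (n⁴ • Ĝ′(1 − P̂)Ĝ′)` RE-INDEXED** along `Prod.fst` (`Ĝ′ = PeriodisedProjector.Ghat (n−1) a s`, `P̂ = Phat (n−1) a s`). -/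
theorem periodiseF_toF_Cgh_eq_submatrix (ha : 0 < a) (hdiv : n ∣ s) :
    Matrix.of (periodiseF s (toF (Cgh n a)))
      = (((n : ℝ) ^ 4) • (Ghat (n - 1) a s * ((1 : Matrix (Site 4 s) (Site 4 s) ℝ) - Phat (n - 1) a s) * Ghat (n - 1) a s)).submatrix
          Prod.fst Prod.fst := by
  rw [periodiseF_toF_Cgh n a ha hdiv, periodiseF_Ggh_eq_submatrix, periodiseF_toF_Rgt_eq_submatrix n a ha, Matrix.submatrix_smul]
  have hbij : Function.Bijective (Prod.fst : Site 4 s × Unit → Site 4 s) := (Equiv.prodPUnit (Site 4 s)).bijective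
  rw [← Matrix.submatrix_mul _ _ Prod.fst Prod.fst Prod.fst hbij, ← Matrix.submatrix_mul _ _ Prod.fst Prod.fst Prod.fst hbij]
  rfl

/-- [folklore] The same read along the inverse re-indexing `x ↦ (x, ())`: `n⁴ • Ĝ′(1 − P̂)Ĝ′ = ((Cgh)^).submatrix ι ι`. -/
theorem submatrix_unit_periodiseF_toF_Cgh (ha : 0 < a) (hdiv : n ∣ s) :
    ((n : ℝ) ^ 4) • (Ghat (n - 1) a s * ((1 : Matrix (Site 4 s) (Site 4 s) ℝ) - Phat (n - 1) a s) * Ghat (n - 1) a s)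
      = (Matrix.of (periodiseF s (toF (Cgh n a)))).submatrix (fun x => (x, ())) (fun y => (y, ())) := by
  rw [periodiseF_toF_Cgh_eq_submatrix n a ha hdiv]
  ext x y
  rfl

end Torus

/-! ## §3 The sockets: torus one-loop functionals of `(Cgh)^` → `ℤ⁴` functionals of `Cgh` (TA3b at `F = Unit`) -/

section Sockets

variable (n : ℕ) [NeZero n] (a : ℝ) {V V' W : MKer 4 Unit} {P P' Q Q' : Site 4} {C Cv Cv' δ : ℝ} {p : ℕ → ℕ} [∀ k, NeZero (p k)]

omit [∀ k, NeZero (p k)] in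
/-- [folklore] `Cgh` is `(n·p k)`-periodic for every `k`. -/
theorem Cgh_imageShift_mul (ha : 0 < a) (k : ℕ) (x y t : Site 4) (u v : Unit) :
    Cgh n a (imageShift (n * p k) x t) (imageShift (n * p k) y t) u v = Cgh n a x y u v :=
  Cgh_imageShift n a ha (Dvd.intro (p k) rfl) x y t u v

/-- [folklore] **THE COMPOSITE-GHOST HESS SOCKET**: for scalar base-point families `𝒱` (first jets `𝒱 μ 0`, `𝒱 ν z`) and `𝒲` (mixed second jet
`𝒲 μ 0 ν z`) bi-localised at a common rate, along the fine tori `Site 4 (n·p k)` with `p k → ∞`: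
`hessT (Cgh)^ (arr (𝒱 μ 0))^ (arr (𝒱 ν z))^ (arr (𝒲 μ 0 ν z))^ → hessKer (Cgh n a) 𝒱 𝒲 μ ν z` (TA3b `tendsto_hessT_hessKer` at `F = Unit`). -/
theorem tendsto_hessT_Cgh (ha : 0 < a) (𝒱 : Fin 4 → Site 4 → MKer 4 Unit) (𝒲 : Fin 4 → Site 4 → Fin 4 → Site 4 → MKer 4 Unit)
    (μ ν : Fin 4) (z : Site 4) (hV : BiLoc (𝒱 μ 0) P P' Cv δ) (hV' : BiLoc (𝒱 ν z) Q' Q Cv' δ) (hW : BiLoc (𝒲 μ 0 ν z) P Q C δ)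
    (hδ : 0 < δ) (hp : Tendsto p atTop atTop) :
    Tendsto (fun k => hessT (Matrix.of (periodiseF (n * p k) (toF (Cgh n a))))
        (Matrix.of (periodiseF (n * p k) (toF (arr (n * p k) (𝒱 μ 0)))))
        (Matrix.of (periodiseF (n * p k) (toF (arr (n * p k) (𝒱 ν z)))))
        (Matrix.of (periodiseF (n * p k) (toF (arr (n * p k) (𝒲 μ 0 ν z))))))
      atTop (𝓝 (hessKer (Cgh n a) 𝒱 𝒲 μ ν z)) := by
  obtain ⟨CA, hdec⟩ := decays_Cgh n a ha
  exact tendsto_hessT_hessKer (σ := fun k => n * p k) hdec (deltaCgh_pos n a ha) (Cgh_imageShift_mul n a ha) 𝒱 𝒲 μ ν z hV hV' hW hδ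
    (tendsto_mul_period n hp)

omit [NeZero n] in
/-- [folklore] **THE `Site ≃ Site × Unit` READING OF `hessT`**: `hessT` of four `Site × Unit`-indexed matrices re-indexed along `x ↦ (x, ())` is the
same number (re-indexing by the `Equiv` `(Equiv.prodPUnit _).symm`) — so TB5-2c-A's site-indexed functionals `hessT Ĉ (…)` are §3's fibred ones. -/
theorem hessT_submatrix_unit {s : ℕ} [NeZero s] (L X X' Y : Matrix (Site 4 s × Unit) (Site 4 s × Unit) ℝ) :
    hessT (L.submatrix (fun x => (x, ())) (fun y => (y, ()))) (X.submatrix (fun x => (x, ())) (fun y => (y, ())))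
        (X'.submatrix (fun x => (x, ())) (fun y => (y, ()))) (Y.submatrix (fun x => (x, ())) (fun y => (y, ())))
      = hessT L X X' Y :=
  hessT_submatrix_equiv (Equiv.prodPUnit (Site 4 s)).symm L X X' Y

end Sockets

end Summit.QuantumFields.BalabanUV.Beta.D1BFx.KGhostLeg

end
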